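import Summits.CriticalPhenomena.PercolationContinuityZ3.Theorems.PercNearOneGluingNoHeavyLowerTailKnQuestion8CoefficientwiseCoreClassKernelMixBundleTraces
import HarnessLib

/-!
# Thread words on a bundle Θ(ℓ₁, …, ℓ_r): exact cluster traces and the lift (glue for THEOREM LP1(Θ), layer 2)

Support file (`--supports stmt-CriticalPhenomena-4575`, closed), prover `prim-cplus-coupling` (gen 43).  No definitions, no notations, no named facts,
no sorries; standard axioms.  Memo `prim-cplus-coupling/A5-COUPLING-gen42.md` §7 and `A5-COUPLING-gen43.md`.

The bundle is explicit as in `…KernelMixBundleTraces` (`r` threads `w t 0 = u, …, w t (L t) = b`, edges `e t j`, threads meeting only at the hubs).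
For a colouring `ω ⊆ E` (red edges) write `C = C_u(ω)`.  This file turns the trace inclusions of `…KernelMixBundleTraces` into the EXACT traces used by
the memo's word calculus:
* `bundle_b_mem_cluster_iff` — `b ∈ C_u(ω)` iff some thread is fully red;
* `bundle_mem_cluster_iff_of_noFull` — no fully red thread ⟹ `w t j ∈ C_u(ω)` iff `j < L t` and `e t 1, …, e t j` are red (the D-side trace `{u} ∪ I_{i(η_t)}`);
* `bundle_mem_cluster_iff_of_b_mem` — `b ∈ C_u(ω)` ⟹ `w t j ∈ C_u(ω)` iff `e t 1..e t j` are red or `e t (j+1)..e t (L t)` are red (the R-side trace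
  `{u, b} ∪ I_i ∪ J_j`; applied to `E ∖ ω` it is the blue trace at demand points);
* `bundle_lift_injOn` — the LIFT 'empty words ↦ full words' on the words of a family of pairwise disjoint threads is injective on words without a
  full thread; `bundle_lift_meets` — after the lift every thread of the family carries a red edge.
These feed the instantiation of `fibre_flows_joins` (…KernelMixFibreFlowsJoins) on a bundle (…KernelMixBundleLP1).
[cite: KozmaNitzan2024, Questions 8–9 (§5.5 p. 36) (context)]
-/

namespace Summit.CriticalPhenomena.PercolationContinuityZ3.Theorems

open Finset Literature.Probability.Percolation

namespace Coefficientwise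

variable {ι V : Type*}

open Classical in
/-- On a bundle (`r ≥ 1` threads of lengths `≥ 1`), `b ∈ C_u(ω)` iff some thread is fully red. [folklore] -/
theorem bundle_b_mem_cluster_iff (ends : ι → Sym2 V) (r : ℕ) (L : ℕ → ℕ) (hL : ∀ t, t < r → 1 ≤ L t)
    (w : ℕ → ℕ → V) (e : ℕ → ℕ → ι) (u b : V) (hr : 0 < r)
    (hw0 : ∀ t, t < r → w t 0 = u) (hwL : ∀ t, t < r → w t (L t) = b)
    (harc : ∀ t, t < r → ∀ j, 1 ≤ j → j ≤ L t → ends (e t j) = s(w t (j - 1), w t j))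
    (hwinj : ∀ t, t < r → ∀ i j, i ≤ L t → j ≤ L t → w t i = w t j → i = j)
    (hcross : ∀ t t', t < r → t' < r → t ≠ t' → ∀ i j, i ≤ L t → j ≤ L t' → w t i = w t' j → (i = 0 ∧ j = 0) ∨ (i = L t ∧ j = L t'))
    (E : Finset ι) (hE : ∀ i, i ∈ E → ∃ t, t < r ∧ ∃ j, 1 ≤ j ∧ j ≤ L t ∧ e t j = i)
    (ω : Finset ι) (hω : ω ⊆ E) :
    b ∈ openCluster (ends '' (↑ω : Set ι)) u ↔ ∃ t, t < r ∧ ∀ j, 1 ≤ j → j ≤ L t → e t j ∈ ω := by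
  constructor
  · intro hb
    by_contra hno
    push Not at hno
    have hnf : ∀ t, t < r → ∃ j, 1 ≤ j ∧ j ≤ L t ∧ e t j ∉ ω := by
      intro t ht
      obtain ⟨j, hj1, hjL, hj⟩ := hno t ht
      exact ⟨j, hj1, hjL, hj⟩
    exact bundle_b_notMem_cluster_of_noFull ends r L hL w e u b hr hw0 hwL harc hwinj hcross E hE ω hω hnf hb
  · rintro ⟨t, ht, hfull⟩
    exact bundle_b_mem_cluster_of_full ends r L w e u b hw0 hwL harc ω t ht hfull

open Classical in
/-- **Exact D-side trace.**  If no thread is fully red, then for `j ≤ L t`: `w t j ∈ C_u(ω)` iff `j < L t` and the whole initial segment `e t 1, …, e t j`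
is red (for `j = 0` this is `u ∈ C_u(ω)`). [folklore] -/
theorem bundle_mem_cluster_iff_of_noFull (ends : ι → Sym2 V) (r : ℕ) (L : ℕ → ℕ) (hL : ∀ t, t < r → 1 ≤ L t)
    (w : ℕ → ℕ → V) (e : ℕ → ℕ → ι) (u : V)
    (hw0 : ∀ t, t < r → w t 0 = u)
    (harc : ∀ t, t < r → ∀ j, 1 ≤ j → j ≤ L t → ends (e t j) = s(w t (j - 1), w t j))
    (hwinj : ∀ t, t < r → ∀ i j, i ≤ L t → j ≤ L t → w t i = w t j → i = j)
    (hcross : ∀ t t', t < r → t' < r → t ≠ t' → ∀ i j, i ≤ L t → j ≤ L t' → w t i = w t' j → (i = 0 ∧ j = 0) ∨ (i = L t ∧ j = L t'))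
    (E : Finset ι) (hE : ∀ i, i ∈ E → ∃ t, t < r ∧ ∃ j, 1 ≤ j ∧ j ≤ L t ∧ e t j = i)
    (ω : Finset ι) (hω : ω ⊆ E) (hnf : ∀ t, t < r → ∃ j, 1 ≤ j ∧ j ≤ L t ∧ e t j ∉ ω)
    (t : ℕ) (ht : t < r) (j : ℕ) (hj : j ≤ L t) :
    w t j ∈ openCluster (ends '' (↑ω : Set ι)) u ↔ (j < L t ∧ ∀ j', 1 ≤ j' → j' ≤ j → e t j' ∈ ω) := by
  constructor
  · intro hmem
    have h := bundle_cluster_subset_prefix ends r L w e u hw0 harc hwinj hcross E hE ω hω hnf hmem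
    rcases h with h0 | ⟨t', ht', j', hj'1, hj'L, hEq, hpre⟩
    · have hj0 : j = 0 := hwinj t ht j 0 hj (Nat.zero_le _) (h0.trans (hw0 t ht).symm)
      subst hj0
      exact ⟨Nat.lt_of_lt_of_le Nat.zero_lt_one (hL t ht), fun j' h1 h2 => by omega⟩
    · by_cases htt : t = t'
      · subst htt
        have hjj : j = j' := hwinj t ht j j' hj (le_of_lt hj'L) hEq
        subst hjj
        exact ⟨hj'L, hpre⟩
      · exfalso
        rcases hcross t t' ht ht' htt j j' hj (le_of_lt hj'L) hEq with ⟨_, h0⟩ | ⟨_, hL'⟩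
        · omega
        · omega
  · rintro ⟨hjL, hpre⟩
    exact bundle_prefix_mem_cluster ends r L w e u hw0 harc ω t ht j hj hpre

open Classical in
/-- **Exact R-side trace.**  If `b ∈ C_u(ω)`, then for `j ≤ L t`: `w t j ∈ C_u(ω)` iff `e t 1, …, e t j` are all red or `e t (j+1), …, e t (L t)` are all red
(for `j = 0`, `j = L t` both sides hold). [folklore] -/
theorem bundle_mem_cluster_iff_of_b_mem (ends : ι → Sym2 V) (r : ℕ) (L : ℕ → ℕ)
    (w : ℕ → ℕ → V) (e : ℕ → ℕ → ι) (u b : V)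
    (hw0 : ∀ t, t < r → w t 0 = u) (hwL : ∀ t, t < r → w t (L t) = b)
    (harc : ∀ t, t < r → ∀ j, 1 ≤ j → j ≤ L t → ends (e t j) = s(w t (j - 1), w t j))
    (hwinj : ∀ t, t < r → ∀ i j, i ≤ L t → j ≤ L t → w t i = w t j → i = j)
    (hcross : ∀ t t', t < r → t' < r → t ≠ t' → ∀ i j, i ≤ L t → j ≤ L t' → w t i = w t' j → (i = 0 ∧ j = 0) ∨ (i = L t ∧ j = L t'))
    (E : Finset ι) (hE : ∀ i, i ∈ E → ∃ t, t < r ∧ ∃ j, 1 ≤ j ∧ j ≤ L t ∧ e t j = i)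
    (ω : Finset ι) (hω : ω ⊆ E) (hb : b ∈ openCluster (ends '' (↑ω : Set ι)) u)
    (t : ℕ) (ht : t < r) (j : ℕ) (hj : j ≤ L t) :
    w t j ∈ openCluster (ends '' (↑ω : Set ι)) u ↔
      ((∀ j', 1 ≤ j' → j' ≤ j → e t j' ∈ ω) ∨ (∀ j', j < j' → j' ≤ L t → e t j' ∈ ω)) := by
  constructor
  · intro hmem
    have h := bundle_cluster_subset_runs ends r L w e u b hw0 hwL harc hwinj hcross E hE ω hω hmem
    rcases h with h0 | hb' | ⟨t', ht', j', hj'1, hj'L, hEq, hruns⟩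
    · have hj0 : j = 0 := hwinj t ht j 0 hj (Nat.zero_le _) (h0.trans (hw0 t ht).symm)
      subst hj0
      exact Or.inl fun j' h1 h2 => by omega
    · have hjL : j = L t := hwinj t ht j (L t) hj (le_refl _) (hb'.trans (hwL t ht).symm)
      subst hjL
      exact Or.inr fun j' h1 h2 => by omega
    · by_cases htt : t = t'
      · subst htt
        have hjj : j = j' := hwinj t ht j j' hj (le_of_lt hj'L) hEq
        subst hjj
        exact hruns
      · exfalso
        rcases hcross t t' ht ht' htt j j' hj (le_of_lt hj'L) hEq with ⟨_, h0⟩ | ⟨_, hL'⟩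
        · omega
        · omega
  · rintro (hpre | hsuf)
    · exact bundle_prefix_mem_cluster ends r L w e u hw0 harc ω t ht j hj hpre
    · exact bundle_suffix_mem_cluster ends r L w e u b hwL harc ω hb t ht j hj hsuf

/-- **The lift 'empty threads ↦ full threads' is injective on words without a full thread.**  Let `A t` (`t ∈ T`) be pairwise disjoint
edge sets.  For `η` put `lift η = η ∪ ⋃ {A t : t ∈ T, A t ∩ η = ∅}`.  If `η, η'` contain no `A t` (`t ∈ T`) and `lift η = lift η'` then `η = η'`.
[folklore] -/
theorem bundle_lift_injOn [DecidableEq ι] (T : Finset ℕ) (A : ℕ → Finset ι)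
    (hdisj : ∀ t ∈ T, ∀ t' ∈ T, t ≠ t' → Disjoint (A t) (A t'))
    (η η' : Finset ι) (hnf : ∀ t ∈ T, ¬ A t ⊆ η) (hnf' : ∀ t ∈ T, ¬ A t ⊆ η')
    (hlift : η ∪ (T.filter (fun t => Disjoint (A t) η)).biUnion A = η' ∪ (T.filter (fun t => Disjoint (A t) η')).biUnion A) :
    η = η' := by
  -- one inclusion suffices, by symmetry
  have key : ∀ (η η' : Finset ι), (∀ t ∈ T, ¬ A t ⊆ η) →
      η ∪ (T.filter (fun t => Disjoint (A t) η)).biUnion A = η' ∪ (T.filter (fun t => Disjoint (A t) η')).biUnion A → η ⊆ η' := by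
    intro η η' hnf hlift i hi
    have hi' : i ∈ η' ∪ (T.filter (fun t => Disjoint (A t) η')).biUnion A := by
      rw [← hlift]; exact Finset.mem_union_left _ hi
    rcases Finset.mem_union.mp hi' with h | h
    · exact h
    · exfalso
      rw [Finset.mem_biUnion] at h
      obtain ⟨t, htf, hit⟩ := h
      rw [Finset.mem_filter] at htf
      obtain ⟨htT, htdisj⟩ := htf
      -- A t ⊆ lift η' = lift η, and every edge of A t in lift η lies in η (the thread t meets η at i)
      apply hnf t htT
      intro k hk
      have hk' : k ∈ η ∪ (T.filter (fun t => Disjoint (A t) η)).biUnion A := by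
        rw [hlift]
        exact Finset.mem_union_right _ (Finset.mem_biUnion.mpr ⟨t, Finset.mem_filter.mpr ⟨htT, htdisj⟩, hk⟩)
      rcases Finset.mem_union.mp hk' with h1 | h1
      · exact h1
      · exfalso
        rw [Finset.mem_biUnion] at h1
        obtain ⟨t'', ht''f, hkt''⟩ := h1
        rw [Finset.mem_filter] at ht''f
        obtain ⟨ht''T, ht''disj⟩ := ht''f
        by_cases htt : t = t''
        · subst htt
          exact Finset.disjoint_left.mp ht''disj hit hi
        · exact Finset.disjoint_left.mp (hdisj t htT t'' ht''T htt) hk hkt''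
  exact Finset.Subset.antisymm (key η η' hnf hlift) (key η' η hnf' hlift.symm)

/-- After the lift every thread of the family carries an edge of the lifted word: for `t ∈ T` with `A t ≠ ∅`, `A t ∩ lift η ≠ ∅`, i.e.
`¬ Disjoint (A t) (lift η)`. [folklore] -/
theorem bundle_lift_meets [DecidableEq ι] (T : Finset ℕ) (A : ℕ → Finset ι) (η : Finset ι) (t : ℕ) (ht : t ∈ T) (hne : (A t).Nonempty) :
    ¬ Disjoint (A t) (η ∪ (T.filter (fun t => Disjoint (A t) η)).biUnion A) := by
  intro hd
  by_cases h : Disjoint (A t) η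
  · obtain ⟨i, hi⟩ := hne
    have : i ∈ η ∪ (T.filter (fun t => Disjoint (A t) η)).biUnion A :=
      Finset.mem_union_right _ (Finset.mem_biUnion.mpr ⟨t, Finset.mem_filter.mpr ⟨ht, h⟩, hi⟩)
    exact Finset.disjoint_left.mp hd hi this
  · apply h
    exact Finset.disjoint_of_subset_right Finset.subset_union_left hd

/-- A lifted word with an empty thread in the family contains that thread fully: if `t ∈ T` and `Disjoint (A t) η` then `A t ⊆ lift η`. [folklore] -/
theorem bundle_subset_lift_of_disjoint [DecidableEq ι] (T : Finset ℕ) (A : ℕ → Finset ι) (η : Finset ι) (t : ℕ) (ht : t ∈ T)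
    (hd : Disjoint (A t) η) :
    A t ⊆ η ∪ (T.filter (fun t => Disjoint (A t) η)).biUnion A := by
  intro i hi
  exact Finset.mem_union_right _ (Finset.mem_biUnion.mpr ⟨t, Finset.mem_filter.mpr ⟨ht, hd⟩, hi⟩)

/-- Edges of a lifted word: `i ∈ lift η` iff `i ∈ η` or `i ∈ A t` for some `t ∈ T` with `A t ∩ η = ∅`. [folklore] -/
theorem bundle_mem_lift_iff [DecidableEq ι] (T : Finset ℕ) (A : ℕ → Finset ι) (η : Finset ι) (i : ι) :
    i ∈ η ∪ (T.filter (fun t => Disjoint (A t) η)).biUnion A ↔ (i ∈ η ∨ ∃ t ∈ T, Disjoint (A t) η ∧ i ∈ A t) := by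
  rw [Finset.mem_union, Finset.mem_biUnion]
  constructor
  · rintro (h | ⟨t, htf, hit⟩)
    · exact Or.inl h
    · rw [Finset.mem_filter] at htf
      exact Or.inr ⟨t, htf.1, htf.2, hit⟩
  · rintro (h | ⟨t, htT, hd, hit⟩)
    · exact Or.inl h
    · exact Or.inr ⟨t, Finset.mem_filter.mpr ⟨htT, hd⟩, hit⟩

open Classical in
/-- `b ∈ C_u(ω)` iff some thread's edge set `A t` is contained in `ω` (restatement of `bundle_b_mem_cluster_iff` with explicit thread edge sets
`A t = {e t 1, …, e t (L t)}`). [folklore] -/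
theorem bundle_b_mem_cluster_iff_threads (ends : ι → Sym2 V) (r : ℕ) (L : ℕ → ℕ) (hL : ∀ t, t < r → 1 ≤ L t)
    (w : ℕ → ℕ → V) (e : ℕ → ℕ → ι) (u b : V) (hr : 0 < r)
    (hw0 : ∀ t, t < r → w t 0 = u) (hwL : ∀ t, t < r → w t (L t) = b)
    (harc : ∀ t, t < r → ∀ j, 1 ≤ j → j ≤ L t → ends (e t j) = s(w t (j - 1), w t j))
    (hwinj : ∀ t, t < r → ∀ i j, i ≤ L t → j ≤ L t → w t i = w t j → i = j)
    (hcross : ∀ t t', t < r → t' < r → t ≠ t' → ∀ i j, i ≤ L t → j ≤ L t' → w t i = w t' j → (i = 0 ∧ j = 0) ∨ (i = L t ∧ j = L t'))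
    (A : ℕ → Finset ι) (hA : ∀ t, t < r → ∀ i, i ∈ A t ↔ ∃ j, 1 ≤ j ∧ j ≤ L t ∧ e t j = i)
    (E : Finset ι) (hEA : ∀ i, i ∈ E ↔ ∃ t, t < r ∧ i ∈ A t)
    (ω : Finset ι) (hω : ω ⊆ E) :
    b ∈ openCluster (ends '' (↑ω : Set ι)) u ↔ ∃ t, t < r ∧ A t ⊆ ω := by
  have hE : ∀ i, i ∈ E → ∃ t, t < r ∧ ∃ j, 1 ≤ j ∧ j ≤ L t ∧ e t j = i := by
    intro i hi
    obtain ⟨t, ht, hit⟩ := (hEA i).mp hi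
    exact ⟨t, ht, (hA t ht i).mp hit⟩
  rw [bundle_b_mem_cluster_iff ends r L hL w e u b hr hw0 hwL harc hwinj hcross E hE ω hω]
  constructor
  · rintro ⟨t, ht, hfull⟩
    refine ⟨t, ht, fun i hi => ?_⟩
    obtain ⟨j, hj1, hjL, rfl⟩ := (hA t ht i).mp hi
    exact hfull j hj1 hjL
  · rintro ⟨t, ht, hsub⟩
    exact ⟨t, ht, fun j hj1 hjL => hsub ((hA t ht _).mpr ⟨j, hj1, hjL, rfl⟩)⟩

open Classical in
/-- **The demand region in thread words.**  For threads `p ≠ q` with edge sets `P = A p`, `Q = A q`, the other threads `T = {t < r : t ≠ p, q}` and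
`O = E ∖ (P ∪ Q)`: a colouring `ω ⊆ E` is a DEMAND point (`b ∈ C_u(E∖ω) ∖ C_u(ω)`, i.e. some thread fully blue and no thread fully red) iff
`ω ∩ P ≠ P`, `ω ∩ Q ≠ Q`, no other thread lies in `ω ∩ O`, and (`ω ∩ P = ∅` or `ω ∩ Q = ∅` or some other thread misses `ω ∩ O`) — the predicate `D`
of `fibre_flows_joins`. [folklore] -/
theorem bundle_demand_iff (ends : ι → Sym2 V) (r : ℕ) (L : ℕ → ℕ) (hL : ∀ t, t < r → 1 ≤ L t)
    (w : ℕ → ℕ → V) (e : ℕ → ℕ → ι) (u b : V)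
    (hw0 : ∀ t, t < r → w t 0 = u) (hwL : ∀ t, t < r → w t (L t) = b)
    (harc : ∀ t, t < r → ∀ j, 1 ≤ j → j ≤ L t → ends (e t j) = s(w t (j - 1), w t j))
    (hwinj : ∀ t, t < r → ∀ i j, i ≤ L t → j ≤ L t → w t i = w t j → i = j)
    (hcross : ∀ t t', t < r → t' < r → t ≠ t' → ∀ i j, i ≤ L t → j ≤ L t' → w t i = w t' j → (i = 0 ∧ j = 0) ∨ (i = L t ∧ j = L t'))
    (A : ℕ → Finset ι) (hA : ∀ t, t < r → ∀ i, i ∈ A t ↔ ∃ j, 1 ≤ j ∧ j ≤ L t ∧ e t j = i)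
    (hAdisj : ∀ t t', t < r → t' < r → t ≠ t' → Disjoint (A t) (A t'))
    (E : Finset ι) (hEA : ∀ i, i ∈ E ↔ ∃ t, t < r ∧ i ∈ A t)
    (p q : ℕ) (hp : p < r) (hq : q < r) (ω : Finset ι) (hω : ω ⊆ E) :
    ((ω ∩ A p ≠ A p ∧ ω ∩ A q ≠ A q ∧
        (∀ t ∈ (Finset.range r).filter (fun t => t ≠ p ∧ t ≠ q), ¬ A t ⊆ ω ∩ (E \ (A p ∪ A q))) ∧
        (ω ∩ A p = ∅ ∨ ω ∩ A q = ∅ ∨ ∃ t ∈ (Finset.range r).filter (fun t => t ≠ p ∧ t ≠ q), Disjoint (A t) (ω ∩ (E \ (A p ∪ A q))))) ↔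
      (b ∈ openCluster (ends '' (↑(E \ ω) : Set ι)) u ∧ b ∉ openCluster (ends '' (↑ω : Set ι)) u)) := by
  have hr : 0 < r := lt_of_le_of_lt (Nat.zero_le p) hp
  have hAE : ∀ t, t < r → A t ⊆ E := fun t ht i hi => (hEA i).mpr ⟨t, ht, hi⟩
  have memT : ∀ t, t ∈ (Finset.range r).filter (fun t => t ≠ p ∧ t ≠ q) ↔ (t < r ∧ t ≠ p ∧ t ≠ q) := by
    intro t; rw [Finset.mem_filter, Finset.mem_range]
  have hAO : ∀ t, t < r → t ≠ p → t ≠ q → A t ⊆ E \ (A p ∪ A q) := by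
    intro t htr htp htq i hi
    rw [Finset.mem_sdiff, Finset.mem_union]
    refine ⟨hAE t htr hi, ?_⟩
    rintro (h1 | h1)
    · exact Finset.disjoint_left.mp (hAdisj t p htr hp htp) hi h1
    · exact Finset.disjoint_left.mp (hAdisj t q htr hq htq) hi h1
  have hfull := bundle_b_mem_cluster_iff_threads ends r L hL w e u b hr hw0 hwL harc hwinj hcross A hA E hEA ω hω
  have hfullc := bundle_b_mem_cluster_iff_threads ends r L hL w e u b hr hw0 hwL harc hwinj hcross A hA E hEA (E \ ω) Finset.sdiff_subset
  constructor
  · rintro ⟨h1, h2, h3, h4⟩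
    refine ⟨?_, ?_⟩
    · -- some thread is blue
      rw [hfullc]
      rcases h4 with h4 | h4 | h4
      · refine ⟨p, hp, fun i hi => Finset.mem_sdiff.mpr ⟨hAE p hp hi, fun hiω => ?_⟩⟩
        have hmem : i ∈ ω ∩ A p := Finset.mem_inter.mpr ⟨hiω, hi⟩
        rw [h4] at hmem; exact Finset.notMem_empty _ hmem
      · refine ⟨q, hq, fun i hi => Finset.mem_sdiff.mpr ⟨hAE q hq hi, fun hiω => ?_⟩⟩
        have hmem : i ∈ ω ∩ A q := Finset.mem_inter.mpr ⟨hiω, hi⟩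
        rw [h4] at hmem; exact Finset.notMem_empty _ hmem
      · obtain ⟨t, htT, hdisj⟩ := h4
        obtain ⟨htr, htp, htq⟩ := (memT t).mp htT
        refine ⟨t, htr, fun i hi => Finset.mem_sdiff.mpr ⟨hAE t htr hi, fun hiω => ?_⟩⟩
        exact Finset.disjoint_left.mp hdisj hi (Finset.mem_inter.mpr ⟨hiω, hAO t htr htp htq hi⟩)
    · -- no thread is red
      rw [hfull]
      rintro ⟨t, htr, hsub⟩
      by_cases htp : t = p
      · rw [htp] at hsub; exact h1 (Finset.inter_eq_right.mpr hsub)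
      by_cases htq : t = q
      · rw [htq] at hsub; exact h2 (Finset.inter_eq_right.mpr hsub)
      exact h3 t ((memT t).mpr ⟨htr, htp, htq⟩) (fun i hi => Finset.mem_inter.mpr ⟨hsub hi, hAO t htr htp htq hi⟩)
  · rintro ⟨hbY, hbX⟩
    rw [hfull] at hbX
    rw [hfullc] at hbY
    obtain ⟨t₀, ht₀, hsub₀⟩ := hbY
    have hdis : Disjoint (A t₀) ω := Finset.disjoint_left.mpr fun i hi hiω => (Finset.mem_sdiff.mp (hsub₀ hi)).2 hiω
    refine ⟨?_, ?_, ?_, ?_⟩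
    · intro hPP; exact hbX ⟨p, hp, Finset.inter_eq_right.mp hPP⟩
    · intro hQQ; exact hbX ⟨q, hq, Finset.inter_eq_right.mp hQQ⟩
    · intro t htT hsub
      exact hbX ⟨t, ((memT t).mp htT).1, fun i hi => (Finset.mem_inter.mp (hsub hi)).1⟩
    · by_cases h0p : t₀ = p
      · left; rw [h0p] at hdis; exact Finset.disjoint_iff_inter_eq_empty.mp hdis.symm
      by_cases h0q : t₀ = q
      · right; left; rw [h0q] at hdis; exact Finset.disjoint_iff_inter_eq_empty.mp hdis.symm
      right; right
      exact ⟨t₀, (memT t₀).mpr ⟨ht₀, h0p, h0q⟩, Finset.disjoint_of_subset_right Finset.inter_subset_left hdis⟩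

open Classical in
/-- **D-side red trace as a word set.**  If `b ∉ C_u(ω)` (no fully red thread) then, for `j ≤ L t`, `w t j ∈ C_u(ω)` iff `w t j` lies in the
word set `X_D(ω ∩ A t) = {w t j' : j' < L t, e t 1..e t j' ∈ ω ∩ A t}` (= `{u} ∪` the leading red run of thread `t`). [folklore] -/
theorem bundle_traceD_iff (ends : ι → Sym2 V) (r : ℕ) (L : ℕ → ℕ) (hL : ∀ t, t < r → 1 ≤ L t)
    (w : ℕ → ℕ → V) (e : ℕ → ℕ → ι) (u b : V)
    (hw0 : ∀ t, t < r → w t 0 = u) (hwL : ∀ t, t < r → w t (L t) = b)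
    (harc : ∀ t, t < r → ∀ j, 1 ≤ j → j ≤ L t → ends (e t j) = s(w t (j - 1), w t j))
    (hwinj : ∀ t, t < r → ∀ i j, i ≤ L t → j ≤ L t → w t i = w t j → i = j)
    (hcross : ∀ t t', t < r → t' < r → t ≠ t' → ∀ i j, i ≤ L t → j ≤ L t' → w t i = w t' j → (i = 0 ∧ j = 0) ∨ (i = L t ∧ j = L t'))
    (A : ℕ → Finset ι) (hA : ∀ t, t < r → ∀ i, i ∈ A t ↔ ∃ j, 1 ≤ j ∧ j ≤ L t ∧ e t j = i)
    (E : Finset ι) (hEA : ∀ i, i ∈ E ↔ ∃ t, t < r ∧ i ∈ A t)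
    (ω : Finset ι) (hω : ω ⊆ E) (hbX : b ∉ openCluster (ends '' (↑ω : Set ι)) u)
    (t : ℕ) (ht : t < r) (j : ℕ) (hj : j ≤ L t) :
    w t j ∈ openCluster (ends '' (↑ω : Set ι)) u ↔
      w t j ∈ {x : V | ∃ j', j' < L t ∧ x = w t j' ∧ ∀ j'', 1 ≤ j'' → j'' ≤ j' → e t j'' ∈ ω ∩ A t} := by
  have hr : 0 < r := lt_of_le_of_lt (Nat.zero_le t) ht
  have hE : ∀ i, i ∈ E → ∃ t, t < r ∧ ∃ j, 1 ≤ j ∧ j ≤ L t ∧ e t j = i := by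
    intro i hi
    obtain ⟨t, ht, hit⟩ := (hEA i).mp hi
    exact ⟨t, ht, (hA t ht i).mp hit⟩
  have heA : ∀ j', 1 ≤ j' → j' ≤ L t → e t j' ∈ A t := fun j' hj1 hjL => (hA t ht _).mpr ⟨j', hj1, hjL, rfl⟩
  have hnf : ∀ t, t < r → ∃ j, 1 ≤ j ∧ j ≤ L t ∧ e t j ∉ ω := by
    intro t' ht'
    by_contra hcon
    push Not at hcon
    apply hbX
    rw [bundle_b_mem_cluster_iff_threads ends r L hL w e u b hr hw0 hwL harc hwinj hcross A hA E hEA ω hω]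
    refine ⟨t', ht', fun i hi => ?_⟩
    obtain ⟨j', hj'1, hj'L, rfl⟩ := (hA t' ht' i).mp hi
    exact hcon j' hj'1 hj'L
  rw [bundle_mem_cluster_iff_of_noFull ends r L hL w e u hw0 harc hwinj hcross E hE ω hω hnf t ht j hj, Set.mem_setOf_eq]
  constructor
  · rintro ⟨hjL, hrun⟩
    exact ⟨j, hjL, rfl, fun j' h1 h2 => Finset.mem_inter.mpr ⟨hrun j' h1 h2, heA j' h1 (by omega)⟩⟩
  · rintro ⟨j₂, hj₂L, hEq, hrun⟩
    have hjj : j = j₂ := hwinj t ht j j₂ hj (le_of_lt hj₂L) hEq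
    subst hjj
    exact ⟨hj₂L, fun j' h1 h2 => (Finset.mem_inter.mp (hrun j' h1 h2)).1⟩

open Classical in
/-- **D-side blue trace as a word set.**  If `b ∈ C_u(E ∖ ω)` (some fully blue thread) then, for `j ≤ L t`, `w t j ∈ C_u(E ∖ ω)` iff `w t j` lies
in `Y_D(ω ∩ A t) = {w t j' : j' ≤ L t, (e t 1..e t j' ∉ ω ∩ A t) ∨ (e t (j'+1)..e t (L t) ∉ ω ∩ A t)}` (= `{u, b} ∪` leading ∪ trailing blue runs).
[folklore] -/
theorem bundle_traceDc_iff (ends : ι → Sym2 V) (r : ℕ) (L : ℕ → ℕ)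
    (w : ℕ → ℕ → V) (e : ℕ → ℕ → ι) (u b : V)
    (hw0 : ∀ t, t < r → w t 0 = u) (hwL : ∀ t, t < r → w t (L t) = b)
    (harc : ∀ t, t < r → ∀ j, 1 ≤ j → j ≤ L t → ends (e t j) = s(w t (j - 1), w t j))
    (hwinj : ∀ t, t < r → ∀ i j, i ≤ L t → j ≤ L t → w t i = w t j → i = j)
    (hcross : ∀ t t', t < r → t' < r → t ≠ t' → ∀ i j, i ≤ L t → j ≤ L t' → w t i = w t' j → (i = 0 ∧ j = 0) ∨ (i = L t ∧ j = L t'))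
    (A : ℕ → Finset ι) (hA : ∀ t, t < r → ∀ i, i ∈ A t ↔ ∃ j, 1 ≤ j ∧ j ≤ L t ∧ e t j = i)
    (E : Finset ι) (hEA : ∀ i, i ∈ E ↔ ∃ t, t < r ∧ i ∈ A t)
    (ω : Finset ι) (hbY : b ∈ openCluster (ends '' (↑(E \ ω) : Set ι)) u)
    (t : ℕ) (ht : t < r) (j : ℕ) (hj : j ≤ L t) :
    w t j ∈ openCluster (ends '' (↑(E \ ω) : Set ι)) u ↔
      w t j ∈ {x : V | ∃ j', j' ≤ L t ∧ x = w t j' ∧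
        ((∀ j'', 1 ≤ j'' → j'' ≤ j' → e t j'' ∉ ω ∩ A t) ∨ (∀ j'', j' < j'' → j'' ≤ L t → e t j'' ∉ ω ∩ A t))} := by
  have hE : ∀ i, i ∈ E → ∃ t, t < r ∧ ∃ j, 1 ≤ j ∧ j ≤ L t ∧ e t j = i := by
    intro i hi
    obtain ⟨t, ht, hit⟩ := (hEA i).mp hi
    exact ⟨t, ht, (hA t ht i).mp hit⟩
  have heA : ∀ j', 1 ≤ j' → j' ≤ L t → e t j' ∈ A t := fun j' hj1 hjL => (hA t ht _).mpr ⟨j', hj1, hjL, rfl⟩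
  have hAE : A t ⊆ E := fun i hi => (hEA i).mpr ⟨t, ht, hi⟩
  rw [bundle_mem_cluster_iff_of_b_mem ends r L w e u b hw0 hwL harc hwinj hcross E hE (E \ ω) Finset.sdiff_subset hbY t ht j hj,
    Set.mem_setOf_eq]
  have hed : ∀ j', 1 ≤ j' → j' ≤ L t → (e t j' ∈ E \ ω ↔ e t j' ∉ ω ∩ A t) := by
    intro j' h1 h2
    rw [Finset.mem_sdiff, Finset.mem_inter]
    constructor
    · rintro ⟨_, hn⟩ ⟨hm, _⟩; exact hn hm
    · intro hn; exact ⟨hAE (heA j' h1 h2), fun hm => hn ⟨hm, heA j' h1 h2⟩⟩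
  constructor
  · intro hruns
    refine ⟨j, hj, rfl, ?_⟩
    rcases hruns with hrun | hrun
    · exact Or.inl fun j' h1 h2 => (hed j' h1 (by omega)).mp (hrun j' h1 h2)
    · exact Or.inr fun j' h1 h2 => (hed j' (by omega) h2).mp (hrun j' h1 h2)
  · rintro ⟨j₂, hj₂L, hEq, hruns⟩
    have hjj : j = j₂ := hwinj t ht j j₂ hj hj₂L hEq
    subst hjj
    rcases hruns with hrun | hrun
    · exact Or.inl fun j' h1 h2 => (hed j' h1 (by omega)).mpr (hrun j' h1 h2)
    · exact Or.inr fun j' h1 h2 => (hed j' (by omega) h2).mpr (hrun j' h1 h2)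

end Coefficientwise

end Summit.CriticalPhenomena.PercolationContinuityZ3.Theorems
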